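import Literature.MathematicalPhysics.QuantumFieldTheory.ConformalBootstrap3D.PointKernelInterval

/-!
# The kernel certificate theorem for LOWER boxes (`Δ_ε < 1`), `s`-covered, identity by pieces

`PCert.boxExcluded_of_kernelC_unboundedS` (PointKernelScover) certifies STRIPS
`[s_lo, s_hi] × [ε_lo, ∞)` with `ε_lo ≥ 1`: its single `ℓ = 0` head row starts at `ε_lo` and every
cell uses the monotone coefficient rule (`a ≥ ℓ + 1`).  A LOWER box `[s_lo, s_hi] × [ε_lo, ε_hi)` with
`½ < ε_lo < ε_hi ≤ 1` (pub-ising3d: `[0.505, 0.510] × [0.6, 0.95)`) needs the two-row table of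
`boxExcluded_of_pointTable₂S` (PointCertificateTableScover): an `ε`-ROW of `ℓ = 0` cells on
`[ε_lo, ε_hi)` by the INTERVAL coefficient rule (cell start `> ½`, `≥ τ`; kernel checkers of
`PointKernelInterval`), the scalar row from `t₀₀ ≤ 3` to `E₀` and the spinning rows by the monotone
rule (the landed `hBlockOK` / `hPartOK` checkers), every head cell `s`-covered (facts `CellFactIS` /
`CellFactS` assembled from piece certificates), the identity obligation (O1) supplied PER `s`-PIECE
(each piece by the landed chord identity checker `o1OKC` through `o1C_hyp`), (M) boxes and (T) as in
`PointKernel`.  This file gives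

* `eMetaOK` / `ehead_hyps` — the meta checks of the `ε`-row segments;
* `boxExcluded_of_pointTable₂SE` — the two-row table theorem with the head hypotheses in the
  kernel's existential per-cell form and (O1) direct;
* `PCert.boxExcluded_of_kernelC_lowerS` — the kernel certificate theorem, conclusion
  `BoxExcluded (QBoxL slo shi εlo εhi)`.

[cite: HogervorstRychkov2013, §3 eq. (3.6)]
-/

noncomputable section

namespace Literature.MathematicalPhysics.QuantumFieldTheory.ConformalBootstrap3D

open Literature.Analysis.ValidatedNumerics (rall of_rall)
open Real Finset Set

/-! ### The two-row lower table, existential per-cell form, identity direct -/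

/-- **Two-row LOWER-box table, `s`-covered head cells in existential form, (O1) direct.** As
`boxExcluded_of_pointTable₂S` with: (O1) the hypothesis `0 < φ_s(1)` on `Q` itself; the `ε`-row
(`ℓ = 0`, `[ε_lo, ε_hi)`) by the INTERVAL rule only (every cell start `> ½` and `≥ τ`, numbers
`headNumberI`); the scalar / spinning rows by the MONOTONE rule only (cell start `≥ ℓ + 1`, numbers
`headNumber`); each head cell certified by SOME monotone partition `s_lo = σ_0 ≤ ⋯ ≤ σ_P = s_hi`
(`P ≥ 1`) with the number `≥ 0` on every piece; (M) boxes full width.  CONCLUSION: `BoxExcluded Q`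
for `Q ⊆ [s_lo, s_hi] × ([ε_lo, ε_hi) ∪ [t₀₀, E₀))`. [cite: HogervorstRychkov2013, §3 eq. (3.6)] -/
theorem boxExcluded_of_pointTable₂SE {N : ℕ} {w z zb : Fin N → ℝ}
    (hz : ∀ k, z k ∈ Ioo (0 : ℝ) 1) (hzb : ∀ k, zb k ∈ Ioo (0 : ℝ) 1) (hord : ∀ k, zb k ≤ z k)
    (apex : Fin N) (hapex : 0 ≤ w apex) (qd qr : Fin N → ℝ) (hqd : ∀ k, 0 < qd k ∧ qd k ≤ 1)
    (hqr : ∀ k, 0 < qr k ∧ qr k ≤ 1)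
    (hdomd : ∀ k, z k * zb k ≤ qd k ^ 2 * (z apex * zb apex) ∧ z k ≤ qd k * z apex)
    (hdomr : ∀ k, (1 - z k) * (1 - zb k) ≤ qr k ^ 2 * (z apex * zb apex) ∧
      1 - zb k ≤ qr k * z apex)
    {Q : Set (ℝ × ℝ)} {slo shi εlo εhi E₀ ET τ : ℝ}
    (t : ℕ → ℕ → ℝ) (K : ℕ → ℕ) (nF : ℕ → ℕ → ℕ) (hc : ℕ → ℕ → Bool)
    (tε : ℕ → ℝ) (Kε : ℕ) (nFε : ℕ → ℕ) (hcε : ℕ → Bool)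
    (hQ : ∀ p ∈ Q, (slo ≤ p.1 ∧ p.1 ≤ shi) ∧
      ((εlo ≤ p.2 ∧ p.2 < εhi) ∨ (t 0 0 ≤ p.2 ∧ p.2 < E₀)))
    (L : ℕ) (hL : E₀ ≤ (L : ℝ) + 1) (hτ1 : τ ≤ 1) (hτ0 : τ ≤ E₀)
    (hr : ∀ k, 1 / 2 ≤ ((1 - z k) * (1 - zb k)) ^ (shi - slo) ∧ 1 / 2 ≤ (z k * zb k) ^ (shi - slo))
    -- (O1), on `Q` itself
    (hI : ∀ p ∈ Q, 0 < pointFunctional w z zb (crossF p.1 (-1) (fun _ _ => (1 : ℝ))))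
    -- the ε-row (ℓ = 0), interval rule, s-covered
    (htε : tε 0 = εlo ∧ tε Kε = εhi)
    (hlowε : ∀ k, k < Kε → 1 / 2 < tε k ∧ τ ≤ tε k)
    (hnFε : ∀ k, k < Kε → E₀ ≤ tε k + ((nFε k : ℝ) + 1))
    (hρε : ∀ k, k < Kε → hcε k = true → ∀ i, 1 / 2 ≤ (z i * zb i) ^ ((tε (k + 1) - tε k) / 2) ∧
      1 / 2 ≤ ((1 - z i) * (1 - zb i)) ^ ((tε (k + 1) - tε k) / 2))
    (hheadε : ∀ k < Kε,
      ∃ P : ℕ, ∃ σ : ℕ → ℝ, 0 < P ∧ σ 0 = slo ∧ σ P = shi ∧ (∀ i < P, σ i ≤ σ (i + 1)) ∧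
        ∀ i < P, 0 ≤ headNumberI w z zb 0 (tε k) (tε (k + 1)) (σ i) (σ (i + 1)) (nFε k) (hcε k))
    -- the scalar row (ℓ = 0, from ≤ 3 to E₀) and the spinning rows, monotone rule, s-covered
    (ht0 : t 0 0 ≤ 3 ∧ t 0 (K 0) = E₀)
    (htℓ : ∀ ℓ, Even ℓ → ℓ ≠ 0 → ℓ < L → t ℓ 0 = (ℓ : ℝ) + 1 ∧ t ℓ (K ℓ) = E₀)
    (hlow : ∀ ℓ k, k < K ℓ → (ℓ : ℝ) + 1 ≤ t ℓ k)
    (hnF : ∀ ℓ k, k < K ℓ → E₀ ≤ t ℓ k + ((nF ℓ k : ℝ) + 1))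
    (hρ : ∀ ℓ k, k < K ℓ → hc ℓ k = true → ∀ i, 1 / 2 ≤ (z i * zb i) ^ ((t ℓ (k + 1) - t ℓ k) / 2) ∧
      1 / 2 ≤ ((1 - z i) * (1 - zb i)) ^ ((t ℓ (k + 1) - t ℓ k) / 2))
    (hhead : ∀ ℓ, (ℓ = 0 ∨ (Even ℓ ∧ ℓ < L)) → ∀ k < K ℓ,
      ∃ P : ℕ, ∃ σ : ℕ → ℝ, 0 < P ∧ σ 0 = slo ∧ σ P = shi ∧ (∀ i < P, σ i ≤ σ (i + 1)) ∧
        ∀ i < P, 0 ≤ headNumber w z zb ℓ (t ℓ k) (t ℓ (k + 1)) (σ i) (σ (i + 1)) (nF ℓ k) (hc ℓ k))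
    -- (M) box rows, full width
    (e : ℕ → ℕ → ℝ) (M : ℕ → ℕ) (bc : ℕ → ℕ → Bool)
    (he : ∀ j : ℕ, (j : ℝ) + τ < ET → e j 0 ≤ max E₀ ((j : ℝ) + τ) ∧ ET ≤ e j (M j))
    (hρM : ∀ j m, m < M j → bc j m = true → ∀ k, 1 / 2 ≤ (z k * zb k) ^ ((e j (m + 1) - e j m) / 2) ∧
      1 / 2 ≤ ((1 - z k) * (1 - zb k)) ^ ((e j (m + 1) - e j m) / 2))
    (hbox : ∀ j : ℕ, (j : ℝ) + τ < ET → ∀ m < M j,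
      0 ≤ boxNumber w z zb j (e j m) (e j (m + 1)) slo shi (bc j m))
    -- (T)
    (hB : ∑ k ∈ univ.erase apex, |w k| * ((1 - z k) * (1 - zb k)) ^ slo * qd k ^ ET
          + ∑ k, |w k| * (z k * zb k) ^ slo * qr k ^ ET ≤
          w apex * ((1 - z apex) * (1 - zb apex)) ^ shi) :
    BoxExcluded Q := by
  have hQ1 : ∀ p ∈ Q, slo ≤ p.1 ∧ p.1 ≤ shi := fun p hp => (hQ p hp).1
  have hM := ruleM_of_boxTable_twist w z zb hz hzb τ hQ1 hr e M bc he hρM hbox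
  -- every cell of the scalar and spinning rows (monotone coefficient bit)
  have hcell : ∀ ℓ, (ℓ = 0 ∨ (Even ℓ ∧ ℓ < L)) → ∀ k < K ℓ, ∀ p ∈ Q,
      ∀ Δ ∈ Ico (t ℓ k) (t ℓ (k + 1)), BlockPositive (pointFunctional w z zb) p.1 Δ ℓ := by
    intro ℓ hℓ k hk
    obtain ⟨P, σ, hP, hσ0, hσP, hmono, hnum⟩ := hhead ℓ hℓ k hk
    exact cell_of_headNumber₂_scover w z zb hz hzb hord apex hapex qd qr hqd hqr hdomd hdomr hQ1 hτ1
      hM hB hr (nF ℓ k) (hnF ℓ k hk) (hc ℓ k) false (fun _ => hlow ℓ k hk) (fun h => absurd h (by simp))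
      (hρ ℓ k hk) σ P hP hσ0 hσP hmono
      (fun i hi => by simpa [headNumber₂] using hnum i hi)
  -- every cell of the ε-row (interval coefficient bit)
  have hb0 : unitarityBound3D 0 = 1 / 2 := by simp [unitarityBound3D]
  have hcellε : ∀ k < Kε, ∀ p ∈ Q,
      ∀ Δ ∈ Ico (tε k) (tε (k + 1)), BlockPositive (pointFunctional w z zb) p.1 Δ 0 := by
    intro k hk
    obtain ⟨P, σ, hP, hσ0, hσP, hmono, hnum⟩ := hheadε k hk
    exact cell_of_headNumber₂_scover w z zb hz hzb hord apex hapex qd qr hqd hqr hdomd hdomr hQ1 hτ1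
      hM hB hr (nFε k) (hnFε k hk) (hcε k) true (fun h => absurd h (by simp))
      (fun _ => by
        obtain ⟨h1, h2⟩ := hlowε k hk
        exact ⟨by rw [hb0]; exact h1, by simpa using h2⟩)
      (hρε k hk) σ P hP hσ0 hσP hmono
      (fun i hi => by simpa [headNumber₂] using hnum i hi)
  refine boxExcluded_of_pointRules_twistI hz hzb hord apex hapex qd qr hqd hqr hdomd hdomr hQ1 hτ1 hτ0
    hI ?_ ?_ ?_ hM hB
  · -- (O2): `Δ_ε` lies in the ε-row or in the scalar row
    intro p hp
    rcases (hQ p hp).2 with hε | h0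
    · exact blockPositive_of_cells_Ico tε Kε hcellε p hp p.2 ⟨htε.1 ▸ hε.1, htε.2 ▸ hε.2⟩
    · exact blockPositive_of_cells_Ico (t 0) (K 0) (hcell 0 (Or.inl rfl)) p hp p.2
        ⟨h0.1, ht0.2 ▸ h0.2⟩
  · -- (O3)
    exact scalar_nonneg_of_cells (t 0) (K 0) ht0.1 ht0.2 (hcell 0 (Or.inl rfl))
  · -- (O4)
    exact spinning_nonneg_of_cells L hL t K (fun ℓ hev hℓ hℓL => (htℓ ℓ hev hℓ hℓL).1.le)
      (fun ℓ hev hℓ hℓL => (htℓ ℓ hev hℓ hℓL).2)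
      (fun ℓ hev hℓ hℓL => hcell ℓ (Or.inr ⟨hev, hℓL⟩))

namespace PointKernel

open Literature.Analysis.ValidatedNumerics (rsum rall vget vtab vget_vtab vget_of_length_le rsum_eq_sum
  rall_eq_true_iff of_rall)

/-! ### The lower box and the `ε`-row meta checks -/

/-- the lower box `[slo, shi] × [εlo, εhi)` of a certificate [folklore] -/
def QBoxL (slo shi εlo εhi : ℚ) : Set (ℝ × ℝ) :=
  {p | (((slo : ℚ) : ℝ) ≤ p.1 ∧ p.1 ≤ ((shi : ℚ) : ℝ)) ∧ (((εlo : ℚ) : ℝ) ≤ p.2 ∧ p.2 < ((εhi : ℚ) : ℝ))}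

namespace PCert

/-- meta checks of the `ε`-row (row `0` of the segments `esegs`): nonempty, contiguous, end points
`εlo` / `εhi`, every cell start `a > ½`, `a ≥ τ`, and `E₀ ≤ a + n_F + 1`. [folklore] -/
def eMetaOK (rho : List (ℕ × ℕ)) (esegs : List HSeg) (εlo εhi E0 τ : ℚ) : Bool :=
  let cells := rowCells rho esegs 0
  let K := cells.length
  decide (0 < K) &&
  decide (2 * (cells.getD 0 (0, 0, 0, false)).1 = εlo) &&
  decide (2 * (cells.getD (K - 1) (0, 0, 0, false)).2.1 = εhi) &&
  rall K fun k =>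
    decide (k + 1 < K → (cells.getD k (0, 0, 0, false)).2.1 = (cells.getD (k + 1) (0, 0, 0, false)).1) &&
    decide (1 / 2 < 2 * (cells.getD k (0, 0, 0, false)).1) &&
    decide (τ ≤ 2 * (cells.getD k (0, 0, 0, false)).1) &&
    decide (E0 ≤ 2 * (cells.getD k (0, 0, 0, false)).1 + (((cells.getD k (0, 0, 0, false)).2.2.1 : ℚ) + 1))

/-- **The `ε`-row meta hypotheses from segments**, and: every cell of the row is a cell of a segment
of row `0`, with the `tε_k` its doubled end points. [folklore] -/
theorem ehead_hyps (rho : List (ℕ × ℕ)) (esegs : List HSeg) (εlo εhi E0 τ : ℚ)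
    (h : eMetaOK rho esegs εlo εhi E0 τ = true) :
    (tH rho esegs 0 0 = ((εlo : ℚ) : ℝ) ∧ tH rho esegs 0 (KH rho esegs 0) = ((εhi : ℚ) : ℝ)) ∧
    (∀ k, k < KH rho esegs 0 → 1 / 2 < tH rho esegs 0 k ∧ ((τ : ℚ) : ℝ) ≤ tH rho esegs 0 k) ∧
    (∀ k, k < KH rho esegs 0 → ((E0 : ℚ) : ℝ) ≤ tH rho esegs 0 k + (((nFH rho esegs 0 k : ℕ) : ℝ) + 1)) ∧
    (∀ k, k < KH rho esegs 0 →
      tH rho esegs 0 k = (((2 * (cellAt rho esegs 0 k).1 : ℚ)) : ℝ) ∧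
      tH rho esegs 0 (k + 1) = (((2 * (cellAt rho esegs 0 k).2.1 : ℚ)) : ℝ) ∧
      ∃ i < esegs.length, (segAt esegs i).ell = 0 ∧ cellAt rho esegs 0 k ∈ segCells rho (segAt esegs i)) := by
  simp only [eMetaOK, Bool.and_eq_true, decide_eq_true_eq] at h
  obtain ⟨⟨⟨hK, hs⟩, he⟩, hall⟩ := h
  have rowF : ∀ k < KH rho esegs 0,
      (k + 1 < KH rho esegs 0 → (cellAt rho esegs 0 k).2.1 = (cellAt rho esegs 0 (k + 1)).1) ∧
      1 / 2 < 2 * (cellAt rho esegs 0 k).1 ∧ τ ≤ 2 * (cellAt rho esegs 0 k).1 ∧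
      E0 ≤ 2 * (cellAt rho esegs 0 k).1 + (((cellAt rho esegs 0 k).2.2.1 : ℚ) + 1) := by
    intro k hk
    have := of_rall hall hk
    simp only [Bool.and_eq_true, decide_eq_true_eq] at this
    exact ⟨this.1.1.1, this.1.1.2, this.1.2, this.2⟩
  have hleft : ∀ k, k < KH rho esegs 0 → tHQ rho esegs 0 k = 2 * (cellAt rho esegs 0 k).1 :=
    fun k hk => tHQ_left (fun k' hk' => (rowF k' (by omega)).1 hk') hk
  refine ⟨⟨?_, ?_⟩, fun k hk => ?_, fun k hk => ?_, fun k hk => ?_⟩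
  · rw [tH, hleft 0 hK]
    exact_mod_cast hs
  · rw [tH, show KH rho esegs 0 = (KH rho esegs 0 - 1) + 1 from (Nat.succ_pred_eq_of_pos hK).symm, tHQ_right]
    exact_mod_cast he
  · obtain ⟨-, h1, h2, -⟩ := rowF k hk
    rw [tH, hleft k hk]
    have h1' : (((1 : ℚ) / 2 : ℚ) : ℝ) < (((2 * (cellAt rho esegs 0 k).1 : ℚ)) : ℝ) := Rat.cast_lt.2 h1
    have h2' : ((τ : ℚ) : ℝ) ≤ (((2 * (cellAt rho esegs 0 k).1 : ℚ)) : ℝ) := Rat.cast_le.2 h2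
    have e : (((1 : ℚ) / 2 : ℚ) : ℝ) = 1 / 2 := by norm_num
    exact ⟨by linarith [h1', e], h2'⟩
  · obtain ⟨-, -, -, h3⟩ := rowF k hk
    rw [tH, hleft k hk, nFH]
    have : ((E0 : ℚ) : ℝ) ≤ ((2 * (cellAt rho esegs 0 k).1 +
        (((cellAt rho esegs 0 k).2.2.1 : ℚ) + 1) : ℚ) : ℝ) := by exact_mod_cast h3
    simpa using this
  · refine ⟨by rw [tH, hleft k hk], by rw [tH, tHQ_right], ?_⟩
    have hxmem : cellAt rho esegs 0 k ∈ rowCells rho esegs 0 := by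
      rw [cellAt, List.getD_eq_getElem _ _ (by simpa [KH] using hk)]
      exact List.getElem_mem _
    rw [rowCells, List.mem_flatMap] at hxmem
    obtain ⟨s, hs, hxs⟩ := hxmem
    rw [List.mem_filter] at hs
    obtain ⟨hs, hsl⟩ := hs
    simp only [decide_eq_true_eq] at hsl
    obtain ⟨i, hi, rfl⟩ := List.getElem_of_mem hs
    have hseg : segAt esegs i = esegs[i] := by
      rw [segAt, List.getD_eq_getElem?_getD, List.getElem?_eq_getElem hi, Option.getD_some]
    exact ⟨i, hi, by rw [hseg, hsl], by rw [hseg]; exact hxs⟩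

/-! ### The kernel certificate theorem for lower boxes -/

variable {c : PCert}

/-- **The kernel certificate theorem, LOWER box, `s`-covered head cells, identity by pieces.**
A point certificate with: node / (S) / (T) / meta checks `true`; the identity obligation (O1) on
every piece `[σI_i, σI_{i+1}]` of a rational partition `σI_0 = s_lo`, `σI_{K_I} = s_hi` (each from
a piece certificate's `o1OKC` via `o1C_hyp`); an `ε`-ROW `esegs` of `ℓ = 0` interval cells on
`[ε_lo, ε_hi)` (`eMetaOK`; facts `CellFactIS` from `hBlockOKI` on piece certificates); the scalar
row from `t₀₀ ≤ 3` and the spinning rows (`hMetaOK … t₀₀ E₀ L`; facts `CellFactS`); (M) boxes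
(`j < J`) with nonnegative corner numbers.  CONCLUSION: `BoxExcluded (QBoxL slo shi εlo εhi)`.
[cite: HogervorstRychkov2013, §3 eq. (3.6)] -/
theorem boxExcluded_of_kernelC_lowerS (hc : c.checkNodes = true) (hside : c.sideOK = true)
    (KI : ℕ) (σI : ℕ → ℚ) (hKI : 0 < KI) (hσI0 : σI 0 = c.slo) (hσIK : σI KI = c.shi)
    (hIrow : ∀ i < KI, ∀ s ∈ Icc ((σI i : ℚ) : ℝ) ((σI (i + 1) : ℚ) : ℝ),
      0 < pointFunctional c.wR c.zR c.zbR (crossF s (-1) (fun _ _ => (1 : ℝ))))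
    (qd qr : List ℚ) (ET : ℕ) (hT : c.tOK qd qr ET = true)
    (εlo εhi t00 E0 τ : ℚ) (L J : ℕ) (hpar : paramOK t00 E0 τ L ET J = true)
    (esegs : List HSeg) (hmetaE : eMetaOK c.rho esegs εlo εhi E0 τ = true)
    (hsegs : List HSeg) (hmetaH : hMetaOK c.rho hsegs t00 E0 L = true)
    (mrows : List MRow) (hmetaM : c.mMetaOK mrows E0 τ ET J = true)
    (hecells : ∀ i < esegs.length, ∀ x ∈ segCells c.rho (segAt esegs i), c.CellFactIS (segAt esegs i).ell x)
    (hcells : ∀ i < hsegs.length, ∀ x ∈ segCells c.rho (segAt hsegs i), c.CellFactS (segAt hsegs i).ell x)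
    (hboxes : ∀ j < J, ∀ m < (rowAt mrows j).steps.length,
      0 ≤ termCornerBound c.wR c.zR c.zbR j (c.eM mrows j m) (c.eM mrows j (m + 1))
        ((c.slo : ℚ) : ℝ) ((c.shi : ℚ) : ℝ)) :
    BoxExcluded (QBoxL c.slo c.shi εlo εhi) := by
  simp only [paramOK, Bool.and_eq_true, decide_eq_true_eq] at hpar
  obtain ⟨⟨⟨⟨⟨h3, hL⟩, hτ1⟩, hτ0⟩, hJ⟩, hL0⟩ := hpar
  obtain ⟨hqd, hqr, hdomd, hdomr, hB⟩ := t_hyps hc qd qr ET hT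
  obtain ⟨ht0, htℓ, hlow, hnF, hcell⟩ := head_hyps c.rho hsegs t00 E0 L hmetaH
  obtain ⟨htε, hlowε, hnFε, hcellε⟩ := ehead_hyps c.rho esegs εlo εhi E0 τ hmetaE
  -- the facts of cell `k` of row `ℓ` / of the ε-row
  have hF : ∀ ℓ k, k < KH c.rho hsegs ℓ → c.CellFactS ℓ (cellAt c.rho hsegs ℓ k) := by
    intro ℓ k hk
    obtain ⟨-, -, i, hi, hell, hmem⟩ := hcell ℓ k hk
    have := hcells i hi _ hmem
    rwa [hell] at this
  have hFε : ∀ k, k < KH c.rho esegs 0 → c.CellFactIS 0 (cellAt c.rho esegs 0 k) := by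
    intro k hk
    obtain ⟨-, -, i, hi, hell, hmem⟩ := hcellε k hk
    have := hecells i hi _ hmem
    rwa [hell] at this
  have hhead : ∀ ℓ, (ℓ = 0 ∨ (Even ℓ ∧ ℓ < L)) → ∀ k < KH c.rho hsegs ℓ,
      ∃ P : ℕ, ∃ σ : ℕ → ℝ, 0 < P ∧ σ 0 = ((c.slo : ℚ) : ℝ) ∧ σ P = ((c.shi : ℚ) : ℝ) ∧
        (∀ i < P, σ i ≤ σ (i + 1)) ∧
        ∀ i < P, 0 ≤ headNumber c.wR c.zR c.zbR ℓ (tH c.rho hsegs ℓ k) (tH c.rho hsegs ℓ (k + 1))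
          (σ i) (σ (i + 1)) (nFH c.rho hsegs ℓ k) (bH c.rho hsegs ℓ k) := by
    intro ℓ _ k hk
    obtain ⟨e1, e2, -⟩ := hcell ℓ k hk
    obtain ⟨⟨P, σ, hP, hσ0, hσP, hmono, hnum⟩, -⟩ := hF ℓ k hk
    refine ⟨P, σ, hP, hσ0, hσP, hmono, fun i hi => ?_⟩
    rw [e1, e2, nFH, bH]
    exact hnum i hi
  have hheadε : ∀ k < KH c.rho esegs 0,
      ∃ P : ℕ, ∃ σ : ℕ → ℝ, 0 < P ∧ σ 0 = ((c.slo : ℚ) : ℝ) ∧ σ P = ((c.shi : ℚ) : ℝ) ∧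
        (∀ i < P, σ i ≤ σ (i + 1)) ∧
        ∀ i < P, 0 ≤ headNumberI c.wR c.zR c.zbR 0 (tH c.rho esegs 0 k) (tH c.rho esegs 0 (k + 1))
          (σ i) (σ (i + 1)) (nFH c.rho esegs 0 k) (bH c.rho esegs 0 k) := by
    intro k hk
    obtain ⟨e1, e2, -⟩ := hcellε k hk
    obtain ⟨⟨P, σ, hP, hσ0, hσP, hmono, hnum⟩, -⟩ := hFε k hk
    refine ⟨P, σ, hP, hσ0, hσP, hmono, fun i hi => ?_⟩
    rw [e1, e2, nFH, bH]
    exact hnum i hi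
  have hρ : ∀ ℓ k, k < KH c.rho hsegs ℓ → bH c.rho hsegs ℓ k = true → ∀ i : Fin c.N,
      1 / 2 ≤ (c.zR i * c.zbR i) ^ ((tH c.rho hsegs ℓ (k + 1) - tH c.rho hsegs ℓ k) / 2) ∧
      1 / 2 ≤ ((1 - c.zR i) * (1 - c.zbR i)) ^ ((tH c.rho hsegs ℓ (k + 1) - tH c.rho hsegs ℓ k) / 2) := by
    intro ℓ k hk hb i
    obtain ⟨e1, e2, -⟩ := hcell ℓ k hk
    rw [e1, e2]
    exact (hF ℓ k hk).2 hb i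
  have hρε : ∀ k, k < KH c.rho esegs 0 → bH c.rho esegs 0 k = true → ∀ i : Fin c.N,
      1 / 2 ≤ (c.zR i * c.zbR i) ^ ((tH c.rho esegs 0 (k + 1) - tH c.rho esegs 0 k) / 2) ∧
      1 / 2 ≤ ((1 - c.zR i) * (1 - c.zbR i)) ^ ((tH c.rho esegs 0 (k + 1) - tH c.rho esegs 0 k) / 2) := by
    intro k hk hb i
    obtain ⟨e1, e2, -⟩ := hcellε k hk
    rw [e1, e2]
    exact (hFε k hk).2 hb i
  have hJR : ((ET : ℕ) : ℝ) ≤ (J : ℝ) + ((τ : ℚ) : ℝ) := by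
    have : (((ET : ℚ)) : ℝ) ≤ (((J : ℚ) + τ : ℚ) : ℝ) := by exact_mod_cast hJ
    push_cast at this; exact this
  obtain ⟨he, hρM, hbox⟩ := ruleM_hyps mrows E0 τ ET J hJR hmetaM hboxes
  -- (O1) from the pieces
  have hI : ∀ p ∈ QBoxL c.slo c.shi εlo εhi,
      0 < pointFunctional c.wR c.zR c.zbR (crossF p.1 (-1) (fun _ _ => (1 : ℝ))) := by
    intro p hp
    obtain ⟨i, hi, hs⟩ := exists_piece_Icc (fun i => ((σI i : ℚ) : ℝ)) KI hKI p.1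
      ⟨by simp only [hσI0]; exact hp.1.1, by simp only [hσIK]; exact hp.1.2⟩
    exact hIrow i hi p.1 hs
  refine boxExcluded_of_pointTable₂SE (w := c.wR) (z := c.zR) (zb := c.zbR)
    (slo := ((c.slo : ℚ) : ℝ)) (shi := ((c.shi : ℚ) : ℝ)) (εlo := ((εlo : ℚ) : ℝ)) (εhi := ((εhi : ℚ) : ℝ))
    (E₀ := ((E0 : ℚ) : ℝ)) (ET := ((ET : ℕ) : ℝ)) (τ := ((τ : ℚ) : ℝ))
    (zR_mem hc) (zbR_mem hc) ?_ ⟨c.apex, apex_lt hc⟩ ?_ (c.qR qd) (c.qR qr) hqd hqr hdomd hdomr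
    (tH c.rho hsegs) (KH c.rho hsegs) (nFH c.rho hsegs) (bH c.rho hsegs)
    (tH c.rho esegs 0) (KH c.rho esegs 0) (nFH c.rho esegs 0) (bH c.rho esegs 0)
    (fun p hp => ⟨hp.1, Or.inl hp.2⟩) L (by exact_mod_cast hL) (by exact_mod_cast hτ1)
    (by exact_mod_cast hτ0) (side_hyp hside) hI htε hlowε hnFε hρε hheadε
    (⟨by rw [ht0.1]; exact_mod_cast h3, ht0.2⟩) htℓ hlow hnF hρ hhead
    (c.eM mrows) (fun j => (rowAt mrows j).steps.length) (fun _ _ => false) he hρM hbox hB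
  · intro k
    have hn := checkNode_of_checkNodes hc k.2
    simpa [zR, zbR] using (show ((c.zb k : ℚ) : ℝ) ≤ ((c.z k : ℚ) : ℝ) by exact_mod_cast zb_le_z hn)
  · simpa [wR] using (show ((0 : ℚ) : ℝ) ≤ ((c.w c.apex : ℚ) : ℝ) by exact_mod_cast w_apex_nonneg hc)

end PCert

end PointKernel

end Literature.MathematicalPhysics.QuantumFieldTheory.ConformalBootstrap3D
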